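import Summits.CriticalPhenomena.PercolationContinuityZ3.Theorems.PercNearOneGluingNoHeavyLowerTailForestRayleighTools
import HarnessLib

/-!
# Weighted forest negative correlation on graphs of tree-width ≤ 2 — III: series vertex avoiding `e, f`, both edges pinned

Notation as in `…ForestRayleighTools`: `Z(D;K) = Σ_{G ⊆ D, ⟨G ∪ K⟩ acyclic} ∏_{g∈G} w g` and the
Rayleigh inequality `(R)(D;K;e,f) : Z(D;K∪{e,f})·Z(D;K) ≤ Z(D;K∪{e})·Z(D;K∪{f})`.

`forestsW_pin_series`: two PINNED series edges `vu₁, vu₂` at a vertex `v` meeting nothing else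
can be replaced by the pinned chord `u₁u₂` (re-route `vu₂` onto the chord, then drop the pendant
`vu₁`). With it, `lsm_series_pin_pin`: if both edges of the degree-two vertex `v` are pinned
(`K = K₀ ∪ {vu₂, vu₁}`, `vu₁, vu₂ ∉ {e,f}`, chord `h ≠ f`), then `(R)(D;K;e,f)` follows from
`(R)(D ∖ h;K₀ ∪ h;e,f)` (when `h ∈ K₀` or `h = e` both sides vanish: pinned triangle). The mixed
and free cases are `…ForestRayleighStepsMixed` / `…StepsThree`. Graph-language form of
Semple–Welsh, *Negative correlation in graphs and matroids*, CPC 17 (2008), Prop. 3.7.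
Theorems only; no definitions, no `sorry`.
-/

open Finset SimpleGraph
open scoped Classical

namespace Summit.CriticalPhenomena.PercolationContinuityZ3.Theorems.ForestRayleigh

variable {V : Type*} [Fintype V] [DecidableEq V]

/-! ### §1 Two pinned series edges = pinned chord -/

/-- **Pinned series pair.** If `v` meets no edge of `D ∪ X`, `u₁ ≠ u₂`, and the chord `u₁u₂ ∉ D ∪ X`,
then `Z(D;X ∪ {vu₂, vu₁}) = Z(D;X ∪ {u₁u₂})`: a set `G ∪ X ∪ {vu₁,vu₂}` is acyclic iff
`G ∪ X ∪ {u₁u₂}` is. [folklore; S–W Prop. 3.7, series case] -/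
theorem forestsW_pin_series (w : Sym2 V → ℝ) (D X : Finset (Sym2 V))
    (hDX : ∀ x ∈ D ∪ X, ¬x.IsDiag) {v u₁ u₂ : V} (hv : ∀ x ∈ D ∪ X, v ∉ x) (hu : u₁ ≠ u₂)
    (hvu₁ : v ≠ u₁) (hvu₂ : v ≠ u₂) (hh : s(u₁, u₂) ∉ D ∪ X) :
    (∑ G ∈ D.powerset.filter (fun G =>
        (fromEdgeSet ((G ∪ (insert s(v, u₂) (insert s(v, u₁) X)) : Finset (Sym2 V)) : Set (Sym2 V))).IsAcyclic), ∏ x ∈ G, w x) =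
      (∑ G ∈ D.powerset.filter (fun G =>
        (fromEdgeSet ((G ∪ (insert s(u₁, u₂) X) : Finset (Sym2 V)) : Set (Sym2 V))).IsAcyclic), ∏ x ∈ G, w x) := by
  have hvh : v ∉ s(u₁, u₂) := by
    rw [Sym2.mem_iff]; rintro (hh | hh) <;> [exact hvu₁ hh; exact hvu₂ hh]
  have hnd : ¬(s(u₁, u₂) : Sym2 V).IsDiag := fun hh => hu (Sym2.mk_isDiag_iff.1 hh)
  have nd₁ : ∀ x ∈ D ∪ insert s(v, u₁) X, ¬x.IsDiag := by
    intro x hx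
    rw [Finset.union_insert, Finset.mem_insert] at hx
    rcases hx with rfl | hx
    · exact fun hh => hvu₁ (Sym2.mk_isDiag_iff.1 hh)
    · exact hDX x hx
  have nd₂ : ∀ x ∈ D ∪ insert s(u₁, u₂) X, ¬x.IsDiag := by
    intro x hx
    rw [Finset.union_insert, Finset.mem_insert] at hx
    rcases hx with rfl | hx
    · exact hnd
    · exact hDX x hx
  have hv₂ : ∀ x ∈ D ∪ insert s(u₁, u₂) X, v ∉ x := by
    intro x hx
    rw [Finset.union_insert, Finset.mem_insert] at hx
    rcases hx with rfl | hx
    · exact hvh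
    · exact hv x hx
  have hg₂ : s(v, u₂) ∉ D ∪ insert s(v, u₁) X := by
    rw [Finset.union_insert, Finset.mem_insert, not_or]
    exact ⟨fun hh => hu (Sym2.congr_right.1 hh).symm, fun hh => hv _ hh (Sym2.mem_mk_left _ _)⟩
  have hh' : s(u₁, u₂) ∉ D ∪ insert s(v, u₁) X := by
    rw [Finset.union_insert, Finset.mem_insert, not_or]
    exact ⟨fun hh => hvh (hh ▸ Sym2.mem_mk_left _ _), hh⟩
  rw [forestsW_pin_reroute w D (insert s(v, u₁) X) nd₁ (Finset.mem_insert_self _ _) hvu₂ hu hg₂ hh',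
    Finset.insert_comm s(u₁, u₂) s(v, u₁) X]
  exact forestsW_pin_pendant w D (insert s(u₁, u₂) X) nd₂ hv₂ hvu₁.symm

/-- A pinned set containing the two series edges and the chord kills the partition function
(pinned triangle). [elementary] -/
theorem forestsW_pin_series_triangle (w : Sym2 V → ℝ) (D X : Finset (Sym2 V))
    (hX : ∀ x ∈ X, ¬x.IsDiag) {v u₁ u₂ : V} (hu : u₁ ≠ u₂) (hvu₁ : v ≠ u₁) (hvu₂ : v ≠ u₂)
    (h₁ : s(v, u₁) ∈ X) (h₂ : s(v, u₂) ∈ X) (hh : s(u₁, u₂) ∈ X) :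
    (∑ G ∈ D.powerset.filter (fun G =>
        (fromEdgeSet ((G ∪ X : Finset (Sym2 V)) : Set (Sym2 V))).IsAcyclic), ∏ x ∈ G, w x) = 0 :=
  forestsW_eq_zero_of_triangle w D X hX h₁ hh h₂ hvu₁ hu hvu₂

/-! ### §2 Series vertex with both edges pinned -/

/-- **Series vertex with both edges pinned.** `K = K₀ ∪ {vu₂, vu₁}`, `v` meets no other edge of the
instance, `h = u₁u₂ ≠ f`: `(R)(D;K;e,f)` follows from `(R)(D ∖ h;K₀ ∪ h;e,f)` (needed only when
`h ∉ K₀`, `h ≠ e`; otherwise both sides vanish). [S–W Prop. 3.7, series case] -/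
theorem lsm_series_pin_pin (w : Sym2 V → ℝ) (D K₀ : Finset (Sym2 V)) (e f : Sym2 V)
    {v u₁ u₂ : V} (hDK : ∀ x ∈ D ∪ insert e (insert f (insert s(v, u₂) (insert s(v, u₁) K₀))), ¬x.IsDiag)
    (hv : ∀ x ∈ D ∪ insert e (insert f K₀), v ∉ x) (hu : u₁ ≠ u₂) (hhf : s(u₁, u₂) ≠ f)
    (hred : s(u₁, u₂) ∉ K₀ → s(u₁, u₂) ≠ e →
      (∑ G ∈ (D.erase s(u₁, u₂)).powerset.filter (fun G =>
        (fromEdgeSet ((G ∪ (insert e (insert f (insert s(u₁, u₂) K₀))) : Finset (Sym2 V)) : Set (Sym2 V))).IsAcyclic), ∏ x ∈ G, w x) *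
      (∑ G ∈ (D.erase s(u₁, u₂)).powerset.filter (fun G =>
        (fromEdgeSet ((G ∪ (insert s(u₁, u₂) K₀) : Finset (Sym2 V)) : Set (Sym2 V))).IsAcyclic), ∏ x ∈ G, w x) ≤
    (∑ G ∈ (D.erase s(u₁, u₂)).powerset.filter (fun G =>
        (fromEdgeSet ((G ∪ (insert e (insert s(u₁, u₂) K₀)) : Finset (Sym2 V)) : Set (Sym2 V))).IsAcyclic), ∏ x ∈ G, w x) *
      (∑ G ∈ (D.erase s(u₁, u₂)).powerset.filter (fun G =>
        (fromEdgeSet ((G ∪ (insert f (insert s(u₁, u₂) K₀)) : Finset (Sym2 V)) : Set (Sym2 V))).IsAcyclic), ∏ x ∈ G, w x)) :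
    (∑ G ∈ D.powerset.filter (fun G =>
        (fromEdgeSet ((G ∪ (insert e (insert f (insert s(v, u₂) (insert s(v, u₁) K₀)))) : Finset (Sym2 V)) : Set (Sym2 V))).IsAcyclic), ∏ x ∈ G, w x) *
      (∑ G ∈ D.powerset.filter (fun G =>
        (fromEdgeSet ((G ∪ (insert s(v, u₂) (insert s(v, u₁) K₀)) : Finset (Sym2 V)) : Set (Sym2 V))).IsAcyclic), ∏ x ∈ G, w x) ≤
    (∑ G ∈ D.powerset.filter (fun G =>
        (fromEdgeSet ((G ∪ (insert e (insert s(v, u₂) (insert s(v, u₁) K₀))) : Finset (Sym2 V)) : Set (Sym2 V))).IsAcyclic), ∏ x ∈ G, w x) *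
      (∑ G ∈ D.powerset.filter (fun G =>
        (fromEdgeSet ((G ∪ (insert f (insert s(v, u₂) (insert s(v, u₁) K₀))) : Finset (Sym2 V)) : Set (Sym2 V))).IsAcyclic), ∏ x ∈ G, w x) := by
  have hvu₁ : v ≠ u₁ := fun hh => hDK s(v, u₁) (by simp) (Sym2.mk_isDiag_iff.2 hh)
  have hvu₂ : v ≠ u₂ := fun hh => hDK s(v, u₂) (by simp) (Sym2.mk_isDiag_iff.2 hh)
  have hnd : ¬(s(u₁, u₂) : Sym2 V).IsDiag := fun hh => hu (Sym2.mk_isDiag_iff.1 hh)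
  -- normal forms of the four pinned sets: the series pair outermost
  have cₑ : insert e (insert s(v, u₂) (insert s(v, u₁) K₀)) = insert s(v, u₂) (insert s(v, u₁) (insert e K₀)) := by
    rw [Finset.insert_comm e s(v, u₂), Finset.insert_comm e s(v, u₁)]
  have c_f : insert f (insert s(v, u₂) (insert s(v, u₁) K₀)) = insert s(v, u₂) (insert s(v, u₁) (insert f K₀)) := by
    rw [Finset.insert_comm f s(v, u₂), Finset.insert_comm f s(v, u₁)]
  have cₑf : insert e (insert f (insert s(v, u₂) (insert s(v, u₁) K₀))) = insert s(v, u₂) (insert s(v, u₁) (insert e (insert f K₀))) := by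
    rw [Finset.insert_comm f s(v, u₂), Finset.insert_comm f s(v, u₁), Finset.insert_comm e s(v, u₂),
      Finset.insert_comm e s(v, u₁)]
  -- loop-freeness of the pinned sets
  have ndK : ∀ x ∈ insert e (insert f (insert s(v, u₂) (insert s(v, u₁) K₀))), ¬x.IsDiag := fun x hx =>
    hDK x (Finset.mem_union_right _ hx)
  by_cases hz : s(u₁, u₂) ∈ K₀ ∨ s(u₁, u₂) = e
  · -- the pinned sets containing `e` contain the triangle `vu₁, u₁u₂, vu₂`
    have hmem₁ : s(u₁, u₂) ∈ insert e (insert f (insert s(v, u₂) (insert s(v, u₁) K₀))) := by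
      rcases hz with hz | hz
      · simp [hz]
      · rw [hz]; exact Finset.mem_insert_self _ _
    have hmem₂ : s(u₁, u₂) ∈ insert e (insert s(v, u₂) (insert s(v, u₁) K₀)) := by
      rcases hz with hz | hz
      · simp [hz]
      · rw [hz]; exact Finset.mem_insert_self _ _
    rw [forestsW_pin_series_triangle w D _ ndK hu hvu₁ hvu₂ (by simp) (by simp) hmem₁,
      forestsW_pin_series_triangle w D _ (fun x hx => ndK x (by
        simp only [Finset.mem_insert] at hx ⊢; rcases hx with hx | hx | hx | hx <;> simp [hx]))
        hu hvu₁ hvu₂ (by simp) (by simp) hmem₂, zero_mul, zero_mul]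
  have hK : s(u₁, u₂) ∉ K₀ := fun hh => hz (Or.inl hh)
  have he : s(u₁, u₂) ≠ e := fun hh => hz (Or.inr hh)
  have spec := hred hK he
  -- the series surgery on a free set `D' ⊆ D` avoiding `h`, for a pinned remainder `X ⊇ K₀`
  have surg : ∀ D' X : Finset (Sym2 V), D' ⊆ D → s(u₁, u₂) ∉ D' → X ⊆ insert e (insert f K₀) →
      (∑ G ∈ D'.powerset.filter (fun G =>
        (fromEdgeSet ((G ∪ (insert s(v, u₂) (insert s(v, u₁) X)) : Finset (Sym2 V)) : Set (Sym2 V))).IsAcyclic), ∏ x ∈ G, w x) =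
        (∑ G ∈ D'.powerset.filter (fun G =>
        (fromEdgeSet ((G ∪ (insert s(u₁, u₂) X) : Finset (Sym2 V)) : Set (Sym2 V))).IsAcyclic), ∏ x ∈ G, w x) := by
    intro D' X hD' hhD' hX
    refine forestsW_pin_series w D' X ?_ ?_ hu hvu₁ hvu₂ ?_
    · intro x hx
      rcases Finset.mem_union.1 hx with hx | hx
      · exact hDK x (Finset.mem_union_left _ (hD' hx))
      · apply hDK x (Finset.mem_union_right _ _)
        have hx' := hX hx
        simp only [Finset.mem_insert] at hx' ⊢
        rcases hx' with hx' | hx' | hx'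
        · exact Or.inl hx'
        · exact Or.inr (Or.inl hx')
        · exact Or.inr (Or.inr (Or.inr (Or.inr hx')))
    · intro x hx
      rcases Finset.mem_union.1 hx with hx | hx
      · exact hv x (Finset.mem_union_left _ (hD' hx))
      · exact hv x (Finset.mem_union_right _ (hX hx))
    · intro hx
      rcases Finset.mem_union.1 hx with hx | hx
      · exact hhD' (hx)
      · have hx' := hX hx
        simp only [Finset.mem_insert] at hx'
        rcases hx' with hx' | hx' | hx'
        · exact he hx'
        · exact hhf hx'
        · exact hK hx'
  have X₀ : K₀ ⊆ insert e (insert f K₀) := (Finset.subset_insert _ _).trans (Finset.subset_insert _ _)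
  have Xₑ : insert e K₀ ⊆ insert e (insert f K₀) :=
    Finset.insert_subset_insert e (Finset.subset_insert _ _)
  have X_f : insert f K₀ ⊆ insert e (insert f K₀) := Finset.subset_insert _ _
  by_cases hD : s(u₁, u₂) ∈ D
  · -- `h ∈ D`: split off `h`; the copies with `h` pinned next to `vu₁, vu₂` vanish
    have hD' : D = insert s(u₁, u₂) (D.erase s(u₁, u₂)) := (Finset.insert_erase hD).symm
    have hh₁ : s(u₁, u₂) ∉ D.erase s(u₁, u₂) := Finset.notMem_erase _ _
    have sub₁ : D.erase s(u₁, u₂) ⊆ D := Finset.erase_subset _ _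
    have tri : ∀ X : Finset (Sym2 V), X ⊆ insert e (insert f (insert s(v, u₂) (insert s(v, u₁) K₀))) → s(v, u₁) ∈ X → s(v, u₂) ∈ X →
        (∑ G ∈ (D.erase s(u₁, u₂)).powerset.filter (fun G =>
        (fromEdgeSet ((G ∪ (insert s(u₁, u₂) X) : Finset (Sym2 V)) : Set (Sym2 V))).IsAcyclic), ∏ x ∈ G, w x) = 0 := by
      intro X hX h₁ h₂
      refine forestsW_pin_series_triangle w _ _ ?_ hu hvu₁ hvu₂ (Finset.mem_insert_of_mem h₁)
        (Finset.mem_insert_of_mem h₂) (Finset.mem_insert_self _ _)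
      intro x hx
      rcases Finset.mem_insert.1 hx with rfl | hx
      · exact hnd
      · exact ndK x (hX hx)
    have t₁ := tri _ subset_rfl (by simp) (by simp)
    have t₂ := tri _ ((Finset.subset_insert _ _).trans (Finset.subset_insert _ _)) (by simp) (by simp)
    have t₃ := tri _ (Finset.insert_subset_insert e (Finset.subset_insert _ _)) (by simp) (by simp)
    have t₄ := tri (insert f (insert s(v, u₂) (insert s(v, u₁) K₀))) (Finset.subset_insert _ _) (by simp) (by simp)
    rw [hD', forestsW_insert_split w _ _ hh₁, forestsW_insert_split w _ _ hh₁,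
      forestsW_insert_split w _ _ hh₁, forestsW_insert_split w _ _ hh₁, t₁, t₂, t₃, t₄]
    simp only [mul_zero, add_zero]
    rw [cₑf, surg _ _ sub₁ hh₁ subset_rfl, surg _ _ sub₁ hh₁ X₀, cₑ, surg _ _ sub₁ hh₁ Xₑ,
      c_f, surg _ _ sub₁ hh₁ X_f, Finset.insert_comm s(u₁, u₂) e, Finset.insert_comm s(u₁, u₂) f,
      Finset.insert_comm s(u₁, u₂) e]
    exact spec
  · rw [Finset.erase_eq_of_notMem hD] at spec
    rw [cₑf, surg _ _ subset_rfl hD subset_rfl, surg _ _ subset_rfl hD X₀, cₑ,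
      surg _ _ subset_rfl hD Xₑ, c_f, surg _ _ subset_rfl hD X_f, Finset.insert_comm s(u₁, u₂) e,
      Finset.insert_comm s(u₁, u₂) f, Finset.insert_comm s(u₁, u₂) e]
    exact spec


end Summit.CriticalPhenomena.PercolationContinuityZ3.Theorems.ForestRayleigh
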